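import Summits.ABC.StewartYu.PadicMulticubicLiouvillePadic
import Literature.NumberTheory.Transcendental.CijsouwWaldschmidt1977Liouville
import HarnessLib

/-!
# Cell abc-stewartyu, W80Two: the multicubic Liouville inequality for RATIONAL generators (heights)

`Summits/ABC/StewartYu/PadicMulticubicLiouvilleRat.lean` — cell `abc-stewartyu` (seat lit; route
`PadicPrimesW80TwoThirds`, crux `W80Two` stmt-ABC-19486; theorems only, no definition, no named
fact), sequel to lit-g3's `PadicMulticubicLiouville(Padic).lean`, whose `norm_ev3_ge` asks for
INTEGER generators `αⱼ`.  In the `2`-adic engine the generators of the set-up are `α₁,…,α_d` AND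
`θ = ∏ αⱼ^{bⱼ}`, which is a genuine rational as soon as an exponent is negative; so the third-point
step needs the inequality for rational `αⱼ`, with the naive height product
`P(α) = ∏ⱼ max(|num αⱼ|, den αⱼ)` (`CW77.heightProd`, the quantity p2/p3's half-point steps use).

Main results (namespace `Summit.ABC.StewartYu.MulticubLiouville`):
* `ev3_rescale` — `ev3 (m·t) (l ↦ c_l ∏ⱼ mⱼ^{2−lⱼ}) = (∏ⱼ mⱼ²) · ev3 t c`;
* `norm_ev3_ge_rat` — for rational `αⱼ` with the `3`-Kummer condition, roots `tⱼ³ = αⱼ`,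
  `‖tⱼ‖ ≤ 1`, `c ≠ 0`, `D c ∈ ℤ`, `∑|c| ≤ M`:
  `‖ev3 t c‖ ≥ 1/(6 D M P(α)⁵)^{3^{k+1} − 1}` — by clearing denominators (`αⱼ ↦ αⱼ·denⱼ³ ∈ ℤ`,
  `tⱼ ↦ denⱼ tⱼ`, `c_l ↦ c_l ∏ denⱼ^{2−lⱼ}`: same `D`, `ℓ¹ ≤ M ∏ denⱼ²`, `max(1,|αⱼ denⱼ³|) ≤ H(αⱼ)³`)
  in the integer inequality `norm_ev3_ge`;
* `norm_ev3_ge_padic_rat` — the `ℚ_p` instance.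
The exponent `5` on `P(α)` is crude (a rational induction as in `PadicMultiquadraticLiouvilleSharp`
would give `3`); it only moves constants.  Everything is [folklore].
-/

noncomputable section

open Finset

namespace Summit.ABC.StewartYu

namespace MulticubLiouville

open Multicub
open Literature.NumberTheory.Transcendental.CW77 (hgt heightProd one_le_hgt one_le_heightProd
  den_le_hgt)

variable {L : Type*} [NormedField L] [IsUltrametricDist L] [CharZero L] {k : ℕ}

/-! ### Clearing denominators -/

/-- `q · den(q)³ = num(q) · den(q)²` is an integer. [folklore] -/
theorem mul_den_pow_three_eq_intCast (q : ℚ) :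
    q * (q.den : ℚ) ^ 3 = ((q.num * (q.den : ℤ) ^ 2 : ℤ) : ℚ) := by
  push_cast
  calc q * (q.den : ℚ) ^ 3 = (q * q.den) * (q.den : ℚ) ^ 2 := by ring
    _ = q.num * (q.den : ℚ) ^ 2 := by rw [Rat.mul_den_eq_num]

/-- `|num q| ≤ H(q)` (as reals). [folklore] -/
theorem abs_num_le_hgt (q : ℚ) : |(q.num : ℝ)| ≤ hgt q := by
  have e : ((q.num.natAbs : ℕ) : ℝ) = |(q.num : ℝ)| := by
    rw [← Int.cast_natCast, Int.natCast_natAbs, Int.cast_abs]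
  rw [← e]; unfold hgt; exact_mod_cast le_max_left _ _

/-- `max(1, |q den(q)³|) ≤ H(q)³`. [folklore] -/
theorem max_one_abs_mul_den_pow_three_le (q : ℚ) :
    max 1 |((q * (q.den : ℚ) ^ 3 : ℚ) : ℝ)| ≤ hgt q ^ 3 := by
  refine max_le (one_le_pow₀ (one_le_hgt q)) ?_
  rw [mul_den_pow_three_eq_intCast, Rat.cast_intCast]
  push_cast
  rw [abs_mul, abs_pow, abs_of_nonneg (by positivity : (0 : ℝ) ≤ q.den),
    show hgt q ^ 3 = hgt q * hgt q ^ 2 by ring]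
  exact mul_le_mul (abs_num_le_hgt q) (pow_le_pow_left₀ (by positivity) (den_le_hgt q) 2)
    (by positivity) (by linarith [one_le_hgt q])

omit [IsUltrametricDist L] in
/-- **Rescaling the roots**: with `t'ⱼ = mⱼ tⱼ` and `c'_l = c_l ∏ⱼ mⱼ^{2−lⱼ}`,
`ev3 t' c' = (∏ⱼ mⱼ²) · ev3 t c`. [folklore] -/
theorem ev3_rescale (t : Fin k → L) (m : Fin k → ℕ) (c : (Fin k → Fin 3) → ℚ) :
    ev3 (fun j => (m j : L) * t j) (fun l => c l * ∏ j, (m j : ℚ) ^ (2 - (l j : ℕ))) =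
      (∏ j, (m j : L) ^ 2) * ev3 t c := by
  unfold ev3 mono3
  rw [mul_sum]
  refine sum_congr rfl fun l _ => ?_
  have hl : ∀ j, 2 - (l j : ℕ) + (l j : ℕ) = 2 := fun j =>
    Nat.sub_add_cancel (Nat.lt_succ_iff.mp (l j).isLt)
  have e : (∏ j, (m j : L) ^ (2 - (l j : ℕ))) * ∏ j, ((m j : L) * t j) ^ (l j : ℕ) =
      (∏ j, (m j : L) ^ 2) * ∏ j, t j ^ (l j : ℕ) := by
    simp_rw [mul_pow]
    rw [prod_mul_distrib, ← mul_assoc, ← prod_mul_distrib]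
    congr 1
    exact prod_congr rfl fun j _ => by rw [← pow_add, hl]
  push_cast
  rw [mul_assoc, e]
  ring

/-! ### The inequality for rational generators -/

/-- **The multicubic Liouville inequality for RATIONAL generators** (heights): if the rationals
`αⱼ` satisfy the `3`-Kummer condition, `tⱼ³ = αⱼ` with `‖tⱼ‖ ≤ 1`, and `c ≠ 0` has `D c ∈ ℤ`,
`∑_l |c_l| ≤ M` (`D, M ≥ 1`), then `‖∑_l c_l ∏ⱼ tⱼ^{lⱼ}‖ ≥ 1/(6 D M P(α)⁵)^{3^{k+1} − 1}` with
`P(α) = ∏ⱼ max(|num αⱼ|, den αⱼ)`.  Proof: clear denominators and apply `norm_ev3_ge`. [folklore] -/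
theorem norm_ev3_ge_rat (hZ : ∀ z : ℤ, ‖(z : L)‖ ≤ 1)
    (hN : ∀ n : ℕ, n ≠ 0 → (n : ℝ)⁻¹ ≤ ‖(n : L)‖) (k : ℕ) (α : Fin k → ℚ)
    (hind : ∀ κ : Fin k → ℕ, (∃ j, ¬ 3 ∣ κ j) → ∀ γ : ℚ, ∏ j, α j ^ κ j ≠ γ ^ 3)
    (t : Fin k → L) (ht : ∀ j, t j ^ 3 = (α j : L)) (ht1 : ∀ j, ‖t j‖ ≤ 1)
    (c : (Fin k → Fin 3) → ℚ) (hc : c ≠ 0) (D : ℕ) (hD : 1 ≤ D)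
    (hden : ∀ l, ∃ z : ℤ, (D : ℚ) * c l = z) (M : ℝ) (hM : 1 ≤ M)
    (hcM : ∑ l, |(c l : ℝ)| ≤ M) :
    1 / (6 * (D : ℝ) * M * heightProd α ^ 5) ^ (3 ^ (k + 1) - 1) ≤ ‖ev3 t c‖ := by
  -- the cleared data
  set m : Fin k → ℕ := fun j => (α j).den with hm
  set α' : Fin k → ℚ := fun j => α j * (m j : ℚ) ^ 3 with hα'
  set t' : Fin k → L := fun j => (m j : L) * t j with ht'
  set c' : (Fin k → Fin 3) → ℚ := fun l => c l * ∏ j, (m j : ℚ) ^ (2 - (l j : ℕ)) with hc'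
  set Pm : ℕ := ∏ j, m j ^ 2 with hPm
  have hm0 : ∀ j, 0 < m j := fun j => (α j).pos
  have hmQ : ∀ j, (m j : ℚ) ≠ 0 := fun j => by exact_mod_cast (hm0 j).ne'
  -- `α'` is integral, cube-Kummer, with roots `t'` in the unit ball
  have hα'int : ∀ j, ∃ a : ℤ, α' j = a := fun j =>
    ⟨(α j).num * ((α j).den : ℤ) ^ 2, by simp only [hα', hm]; exact mul_den_pow_three_eq_intCast _⟩
  have hind' : ∀ κ : Fin k → ℕ, (∃ j, ¬ 3 ∣ κ j) → ∀ γ : ℚ, ∏ j, α' j ^ κ j ≠ γ ^ 3 := by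
    intro κ hκ γ hγ
    have hP0 : (∏ j, (m j : ℚ) ^ κ j) ≠ 0 := prod_ne_zero_iff.mpr fun j _ => pow_ne_zero _ (hmQ j)
    have e : ∏ j, α' j ^ κ j = (∏ j, α j ^ κ j) * (∏ j, (m j : ℚ) ^ κ j) ^ 3 := by
      rw [← prod_pow, ← prod_mul_distrib]
      exact prod_congr rfl fun j _ => by simp only [hα']; ring
    refine hind κ hκ (γ / ∏ j, (m j : ℚ) ^ κ j) ?_
    rw [div_pow, eq_div_iff (pow_ne_zero _ hP0), ← hγ, e]
  have ht'3 : ∀ j, t' j ^ 3 = (α' j : L) := fun j => by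
    simp only [ht', hα']; push_cast; rw [mul_pow, ht j]; ring
  have ht'1 : ∀ j, ‖t' j‖ ≤ 1 := fun j => by
    simp only [ht']; rw [norm_mul]
    have h1 : ‖(m j : L)‖ ≤ 1 := by have := hZ (m j); push_cast at this; exact this
    exact mul_le_one₀ h1 (norm_nonneg _) (ht1 j)
  -- `c'`: non-zero, same denominator `D`, `ℓ¹ ≤ M ∏ mⱼ²`
  have hc'ne : c' ≠ 0 := by
    intro h0; apply hc; funext l
    have h1 := congr_fun h0 l
    simp only [hc', Pi.zero_apply, mul_eq_zero] at h1
    rcases h1 with h | h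
    · exact h
    · exact absurd h (prod_ne_zero_iff.mpr fun j _ => pow_ne_zero _ (hmQ j))
  have hden' : ∀ l, ∃ z : ℤ, (D : ℚ) * c' l = z := fun l => by
    obtain ⟨z, hz⟩ := hden l
    refine ⟨z * ∏ j, (m j : ℤ) ^ (2 - (l j : ℕ)), ?_⟩
    simp only [hc']; push_cast; rw [← mul_assoc, hz]
  have hPm0 : Pm ≠ 0 := prod_ne_zero_iff.mpr fun j _ => pow_ne_zero _ (hm0 j).ne'
  have hPm1 : (1 : ℝ) ≤ Pm := by exact_mod_cast Nat.one_le_iff_ne_zero.mpr hPm0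
  have hcM' : ∑ l, |(c' l : ℝ)| ≤ M * Pm := by
    calc ∑ l, |(c' l : ℝ)| ≤ ∑ l, |(c l : ℝ)| * Pm := sum_le_sum fun l _ => by
            simp only [hc', hPm]; push_cast; rw [abs_mul]
            refine mul_le_mul_of_nonneg_left ?_ (abs_nonneg _)
            rw [abs_of_nonneg (by positivity)]
            exact prod_le_prod (fun j _ => by positivity) fun j _ =>
              pow_le_pow_right₀ (by exact_mod_cast hm0 j) (Nat.sub_le 2 _)
      _ = (∑ l, |(c l : ℝ)|) * Pm := (sum_mul _ _ _).symm
      _ ≤ M * Pm := mul_le_mul_of_nonneg_right hcM (by positivity)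
  have hMPm : 1 ≤ M * (Pm : ℝ) := one_le_mul_of_one_le_of_one_le hM hPm1
  -- the integer inequality for the cleared data
  have key := norm_ev3_ge hZ hN k α' hα'int hind' t' ht'3 ht'1 c' hc'ne D hD hden' (M * Pm) hMPm hcM'
  -- `‖ev3 t' c'‖ ≤ ‖ev3 t c‖`
  have hle : ‖ev3 t' c'‖ ≤ ‖ev3 t c‖ := by
    rw [show ev3 t' c' = (∏ j, (m j : L) ^ 2) * ev3 t c from ev3_rescale t m c, norm_mul]
    refine mul_le_of_le_one_left (norm_nonneg _) ?_
    have h1 : ‖((Pm : ℤ) : L)‖ ≤ 1 := hZ Pm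
    simp only [hPm] at h1; push_cast at h1; exact h1
  -- comparison of the thresholds: `Pm ≤ P(α)²`, `∏ max(1,|α'ⱼ|) ≤ P(α)³`
  have h1 : (Pm : ℝ) ≤ heightProd α ^ 2 := by
    simp only [hPm]; push_cast
    rw [heightProd, ← prod_pow]
    exact prod_le_prod (fun j _ => by positivity) fun j _ =>
      pow_le_pow_left₀ (by positivity) (den_le_hgt (α j)) 2
  have h2 : ∏ j, max 1 |(α' j : ℝ)| ≤ heightProd α ^ 3 := by
    rw [heightProd, ← prod_pow]
    exact prod_le_prod (fun j _ => by positivity) fun j _ => by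
      simp only [hα', hm]; exact max_one_abs_mul_den_pow_three_le (α j)
  have hprod1 : 1 ≤ ∏ j, max 1 |(α' j : ℝ)| :=
    Finset.prod_induction _ (fun x => 1 ≤ x)
      (fun _ _ ha hb => one_le_mul_of_one_le_of_one_le ha hb) le_rfl fun j _ => le_max_left _ _
  have hD1 : (1 : ℝ) ≤ D := by exact_mod_cast hD
  have hpos : 0 < 6 * (D : ℝ) * (M * Pm) * ∏ j, max 1 |(α' j : ℝ)| := by
    have := one_le_heightProd α; positivity
  have hbound : 6 * (D : ℝ) * (M * Pm) * ∏ j, max 1 |(α' j : ℝ)| ≤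
      6 * D * M * heightProd α ^ 5 := by
    have hM0 : 0 ≤ M := by linarith
    calc 6 * (D : ℝ) * (M * Pm) * ∏ j, max 1 |(α' j : ℝ)|
        = 6 * D * M * ((Pm : ℝ) * ∏ j, max 1 |(α' j : ℝ)|) := by ring
      _ ≤ 6 * D * M * (heightProd α ^ 2 * heightProd α ^ 3) := by
          refine mul_le_mul_of_nonneg_left (mul_le_mul h1 h2 (by positivity) (by positivity)) ?_
          positivity
      _ = 6 * D * M * heightProd α ^ 5 := by ring
  calc 1 / (6 * (D : ℝ) * M * heightProd α ^ 5) ^ (3 ^ (k + 1) - 1)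
      ≤ 1 / (6 * (D : ℝ) * (M * Pm) * ∏ j, max 1 |(α' j : ℝ)|) ^ (3 ^ (k + 1) - 1) :=
        one_div_le_one_div_of_le (pow_pos hpos _) (pow_le_pow_left₀ hpos.le hbound _)
    _ ≤ ‖ev3 t' c'‖ := key
    _ ≤ ‖ev3 t c‖ := hle

/-- **The multicubic Liouville inequality in `ℚ_p` for rational generators**: the `ℚ_p` instance of
`norm_ev3_ge_rat` (`‖z‖_p ≤ 1` on `ℤ`, `‖n‖_p ≥ 1/n`). [folklore] -/
theorem norm_ev3_ge_padic_rat {p : ℕ} [Fact p.Prime] (k : ℕ) (α : Fin k → ℚ)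
    (hind : ∀ κ : Fin k → ℕ, (∃ j, ¬ 3 ∣ κ j) → ∀ γ : ℚ, ∏ j, α j ^ κ j ≠ γ ^ 3)
    (t : Fin k → ℚ_[p]) (ht : ∀ j, t j ^ 3 = (α j : ℚ_[p])) (ht1 : ∀ j, ‖t j‖ ≤ 1)
    (c : (Fin k → Fin 3) → ℚ) (hc : c ≠ 0) (D : ℕ) (hD : 1 ≤ D)
    (hden : ∀ l, ∃ z : ℤ, (D : ℚ) * c l = z) (M : ℝ) (hM : 1 ≤ M)
    (hcM : ∑ l, |(c l : ℝ)| ≤ M) :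
    1 / (6 * (D : ℝ) * M * heightProd α ^ 5) ^ (3 ^ (k + 1) - 1) ≤ ‖ev3 t c‖ :=
  norm_ev3_ge_rat (fun z => Padic.norm_int_le_one z)
    (fun _ hn => Literature.NumberTheory.Transcendental.inv_natCast_le_norm_natCast hn)
    k α hind t ht ht1 c hc D hD hden M hM hcM

end MulticubLiouville

end Summit.ABC.StewartYu

end
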